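import Summits.QuantumFields.YangMills.Theorems.BalabanUVNodesN10B13KernelTowerWalksEntrywiseNumeralsDecorated
import Literature.MathematicalPhysics.QuantumFieldTheory.Balaban1983to89.B13EntrywiseBlockNumerals

/-!
# BalabanUVNodes ∕ N10 AT THE DECORATED KERNEL TOWER OF RECORD — module 67's ENTRYWISE-WITH-LOCATED-NUMERALS junction of [Balaban1988RG2Cluster] Lemmas 1–3 at the layer
# `lamD.toC.toK.layer` of a DECORATED residual layer `lamD : Node00.ResidB13D θ`, RATES EDITION: NODE A's (1.11) numerics + junction-rate chain + letter match
# (`{εΔ κΔ} hηΔ hηε hρε hP2 hμΔ hμε hμκ hκεΔ hεP hkapP hKP`, eleven binders) READ AS n10-w3's located numerals — ONE rate budget + ONE floor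
# (Track A, DAG node N10 [B13]; D-0149 width seat `pub-ymgap-dag-n10-w3` g2, module «67R» of the n10-c lane's census by the lane owner's word (bus WORDS-4, 2026-08-28 02:51Z);
# the rates twin of module 67 = `…EntrywiseNumeralsDecorated` (seat `pub-ymgap-dag-n10-c` g13, p587126) over the numerals file `B13EntrywiseBlockNumerals` (n10-w3 g2, p598246))

WHY (lane census `HOME/pub-ymgap-dag-n10-c/N10-RESIDUAL-CENSUS-v15.md`, class «★ NODE A about the record's own fields», sub-block «(1.11) numerics, a junction rate,
the letter match with `rf`»).  Module 67 displays, among NODE A's letters about the record's own fields, two existential rates `εΔ κΔ`, two dials `ηΔ μΔ` and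
eleven coupling inequalities.  `Literature/…/B13EntrywiseBlockNumerals` (n10-w3 g2) proves that the seven rate inequalities are EQUIVALENT to ONE rate budget
`ηΔ + εP + kapP + 4μΔ ≤ ρΔ` (`rates_of_budget` ∕ `budget_of_rates`) and names the left side of `hKP` as the numeral `kbarFloor`.  THIS FILE is module 67 with
that block so read: a consumer now supplies `hηΔ hP2 hμΔ hbudget hkbar` (five located inequalities about the dials and the letters `ρΔ BΔ mF c₀ M₁ rC` of the
record's own objects) instead of eleven.  With the canonical dials of `B13EntrywiseBlockNumerals.numerals_nodeA` (`ηΔ := 2cp.κ₁∕M₁`, `μΔ := budget∕4`) the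
block is TWO located inequalities; the dial form is kept here because the dials trade the floor against the budget (honest remark in the Literature file).

HONEST FRAMING.  Count-neutral kernel bookkeeping BY NAME over LANDED modules (67 + the numerals file); `lamD.Δ₀ ∕ lamD.J ∕ lamD.Cm ∕ lamD.locF ∕ lamD.P` are
DATA of the layer — NOTHING of Bałaban's `Δ_k`, `G_k(U)`, `Q`, averaging operators is constructed or asserted (NODE 00's reading ∕ N06's Sect.-B road ∕ def-Y
own them); NODE A's ENTRYWISE letters `hEL` (road of record: module 58B ∕ 60 for inverse pieces — thin radius located by n10-w2's `B13InverseLettersNeumannRadius`;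
range + bound + holomorphy for local pieces — `B13PolynomialRangeLetters`, the lane's pencil letters 69–71), the geodesic letter `hGJ`, `hCle hCsupp`, ONE
positivity `hKacc` (floor located by n10-w4's `B13CondTowerAccretiveFloor`), the Lemma 1–2 located inputs about the HIDDEN frame (N09 ∕ N07 ∕ N06 in-edges), the
rung `rf` and the numerics REMAIN HYPOTHESES; dag-n10-d's ₁₃ pin algebra (PIN-ALGEBRA ONE-DECLARER) untouched — the conclusion is the Stage-3-keyed
`Node00.B13LeafOfRecord θ lamD.toC.toK.layer` BY NAME.  N10 NOT discharged; K1⁷ NOT closed; counts unmoved; one finite four-torus programme at fixed ε per run;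
nothing continuum ∕ ℝ⁴ ∕ OS ∕ mass-gap ∕ Clay.  0 `sorry`, 0 `def`, standard axioms.  Filed `--kind proof --supports` K1⁷ «StabilityBAtRecordR13SepCoPH»
(stmt-QuantumFields-20542) `--as helper` of route «BalabanUVNodes».

WHAT THIS FILE PROVES.  §1 `b13LeafOfRecord_decLayer_of_located_entrywise_numerals_rates` ⟹ `B13LeafOfRecord θ lamD.toC.toK.layer`.  Generated from module 67's
signature (binders parsed; the eleven replaced; proof = `numerals_nodeA_of_dials` then module 67 positionally).

References (TYPES and page anchors only): [II] = [Balaban1988RG2Cluster] Lemma 1 p.9, Lemma 2 p.11, Lemma 3 p.20, (1.11) p.5, (2.5)–(2.8) pp.12–14, (2.14)–(2.26)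
pp.15–17, p.21; [I] = [Balaban1987RG1] (1.11)–(1.14) p.262; [B9] = [Balaban1985BackgroundPropagators] Thm 3.10 (3.107)–(3.108) p.416; [Balaban1984PropagatorsII]
Lemma 2.1 (2.61) p.234.
A2 ∕ A6 (director-ym №189 STANDING A6 RULE).  The new five-binder block is jointly inhabited with room (`B13EntrywiseBlockNumerals.exists_letters ∕ exists_binders`);
module 67's block-by-block inhabitants (its docstring: n10-w2's `entrywiseBlockRung_joint_nonvacuous` p586283, n10-w3's `CarriersB13DecoratedTowerWitness` p588148,
`entrywiseBlockRungExchange_joint_nonvacuous` p587888, n10-w1's `exists_letters` p583431, `chain_joint_nonvacuous_226` p586209) stand with the same HONEST LIMITS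
(no single inhabitant of all binders at once; the hidden-frame inputs inhabited by the zero tower; `hPa`, `hcount` trivially).
v1.0.1 (docstring-only edition, 2026-08-28, seat `pub-ymgap-dag-n10-w3` g4; lane census v19 item 4; declarations byte-identical) — ★ VACUITY NOTE (A6,
dag-n10-w3 g4 `Literature/…/Balaban1983to89/B13CountBinderObstruction`, p612518: `no_joint_inhabitant_of_consts ∕ _constsQ8 ∕ _constsQ8A`,
`count_binders_false_of_delta_kappa_le`): the limit «`hPa`, `hcount` trivially» above is WRONG as hoped — «large `a₅`» is NOT available: `hN` (`Lemma3Numerics`: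
`a₅ < c.δ·ℓ·c.κ∕64`) caps `a₅`, and at `Z` = the whole coarse torus with the admissible term `(∅, all bonds)` the θ-FREE count `hcount` ∧ `hPcard` ∧ `hN` force
`1280·(m₃+1)⁴·(ℓ₆+1)³ < c.δ·c.κ`, which EVERY constants family typed in the tree violates (`δκ < 672` for `consts`, `constsQ8 M`, `constsQ8A M α₄`; the odd-L family
`constsOddL L M α₄` of `B13ChainJointNonvacuityOddL` keeps `δ = δw`, `κ = κw`, so the same bound applies).  Hence the binder set of THIS file (as of 64 ∕ 67 ∕ 67RD ∕ 67RDL,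
which display the same three binders) has NO joint inhabitant at the tree's constants families — the theorem is TRUE AS STATED (an implication), its hypothesis
list is not jointly satisfiable there, and it must not be read as evidence that the N10 junction is met.  The artefact is module 64's adoption of
`B13Bound226Numerals.vol_of_counts`' θ-free CONCLUSION as a binder (worst-case per-row-bond cost frozen in); print's p. 20 count is dial-weighted («O(1)(LM)⁴α₅»,
α₅ small), met for any object sizes by small `θ₀ ∕ γ₂ ∕ α₄M⁻⁴` (`B13CountBinderObstruction.dialCount_le_of_dials`).  THE DISPLAY OF RECORD of the N10 junction is the
dial-weighted sibling 67V `…EntrywiseNumeralsDecoratedDialsLocatedVol` (p614443; `hcount ↦ hvol`, `θ₀ ≤ θ₀max` free; lane word INBOX l.31366) ∕ 67VL `…VolDials`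
(p619692), whose hypothesis list IS jointly inhabited: `BalabanUVNodesN10B13BondTowerInhabited.b13LeafOfRecord_inhabited` (p625168) — for every Stage-3′ record with
`8 ≤ θ.ℓ₆ + 1`, `∃ lamD : ResidB13D θ, B13LeafOfRecord θ lamD.toC.toK.layer` (the bond tower of `Node00/CarriersB13BondTower` at `constsOddL (θ.ℓ₆+1) (κw+1) α₄`, via
`…BondTowerReduced` p621116 + `B13ChainJointNonvacuityPrefactorsVol.junction_numerals_joint_witness_vol` p623490).  Nothing of Bałaban's asserted by this note;
count-neutral; N10 NOT discharged.
-/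

noncomputable section

namespace Summit.QuantumFields.YangMills.BalabanUVNodes.N10B13KernelTowerWalksEntrywiseNumeralsDecoratedRates

open Literature.MathematicalPhysics.QuantumFieldTheory.Balaban1983to89
open Literature.MathematicalPhysics.QuantumFieldTheory.Balaban1983to89.DagBinding
open Literature.MathematicalPhysics.QuantumFieldTheory.Balaban1983to89.Node00
open Literature.MathematicalPhysics.QuantumFieldTheory.Balaban1983to89.B13Lemma3Torus (TwoTorusStep)
open Literature.MathematicalPhysics.QuantumFieldTheory.Balaban1983to89.B13Lemma3TorusSocket (TermDomination Lemma3Numerics)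
open Literature.MathematicalPhysics.QuantumFieldTheory.Balaban1983to89.B13Lemma3TorusData
open Metric
open Literature.MathematicalPhysics.QuantumFieldTheory.Balaban1983to89.B16Absorption (pbox)
open Literature.MathematicalPhysics.QuantumFieldTheory.Balaban1983to89.TreeLengthTorus
open Literature.MathematicalPhysics.QuantumFieldTheory.Balaban1983to89.TreeLengthTorusGeometry
open Literature.MathematicalPhysics.QuantumFieldTheory.Balaban1983to89.TreeLengthTorusTransfer
open Literature.MathematicalPhysics.QuantumFieldTheory.Balaban1983to89.B12TreeDecay (kappa₀ K₀)
open Literature.MathematicalPhysics.QuantumFieldTheory.Balaban1983to89.B13PkScaling (Qop scaled)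
open Literature.MathematicalPhysics.QuantumFieldTheory.Balaban1983to89.B13Bound143 (invTau R12)
open Literature.MathematicalPhysics.QuantumFieldTheory.Balaban1983to89.B13Term214 (term214 SepHolOn core214 F214)
open Literature.MathematicalPhysics.QuantumFieldTheory.Balaban1983to89.B13Lemma3TorusTerms (terms Z0)
open Literature.MathematicalPhysics.QuantumFieldTheory.Balaban1983to89.B5TorusCover (UT)
open Literature.MathematicalPhysics.QuantumFieldTheory.Balaban1983to89.B13TermWalkData (TermKernels)
open Literature.MathematicalPhysics.QuantumFieldTheory.Balaban1983to89.NodeOLettersOfWalksAcross (WalkPackage TermWalks)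
open Literature.MathematicalPhysics.QuantumFieldTheory.Balaban1983to89.NodeOLettersOfWalksPerturbative (RefPackage TermWalksRef)
open Literature.MathematicalPhysics.QuantumFieldTheory.Balaban1983to89.B13Sqrt27Accretive (invSqrt)
open Literature.MathematicalPhysics.QuantumFieldTheory.Balaban1983to89.B9Thm37GlueTorus (tdist1)
open Literature.MathematicalPhysics.QuantumFieldTheory.Balaban1983to89.B13Eq111SDecoupling (sDecorate)
open Literature.MathematicalPhysics.QuantumFieldTheory.Balaban1983to89.B13EntrywiseWalks (RawEntryLetters GeodesicDecoration rawEntryTerm)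
open Summit.QuantumFields.YangMills.BalabanUVNodes.N10AtRecord11B13WalksBlockEntrywise (b13LeafOfRecord_of_located_entrywise)
open Summit.QuantumFields.YangMills.BalabanUVNodes.N10B13KernelTowerWalksHolo (measurable_chiY₀)
open scoped Matrix
open Summit.QuantumFields.YangMills.BalabanUVNodes.N10B13KernelTowerWalksEntrywiseNumerals (b13LeafOfRecord_layer_of_located_entrywise_numerals)
open Literature.MathematicalPhysics.QuantumFieldTheory.Balaban1983to89.B13Bound226Numerals (theta0Max gamma2Max m4Min)
open Literature.MathematicalPhysics.QuantumFieldTheory.Balaban1983to89.B13EntrywiseBlockNumerals (kbarFloor numerals_nodeA_of_dials)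
open Summit.QuantumFields.YangMills.BalabanUVNodes.N10B13KernelTowerWalksEntrywiseNumeralsDecorated
  (b13LeafOfRecord_decLayer_of_located_entrywise_numerals)

/-! ## §1. THE ENTRYWISE-WITH-LOCATED-NUMERALS JUNCTION AT THE DECORATED TOWER, RATES EDITION — the (1.11) numerics + junction-rate chain as ONE rate budget + ONE floor -/

section DecLayer

variable (θ : Stage3Params) (lamD : ResidB13D θ)

-- the junction elaborates ≈ 150 binders and a 160–170-argument application; twice the default budget (as the source junction)
set_option maxHeartbeats 400000 in
open Classical in
/-- **THE [B13] LEAF AT THE DECORATED KERNEL TOWER OF RECORD (ENTRYWISE-WITH-LOCATED-NUMERALS, RATES EDITION).**  Module 67's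
`b13LeafOfRecord_decLayer_of_located_entrywise_numerals` with the ELEVEN binders of NODE A's (1.11) numerics + junction-rate chain + letter match —
`{εΔ κΔ} hηΔ hηε hρε hP2 hμΔ hμε hμκ hκεΔ hεP hkapP hKP` — REPLACED by the dial form of n10-w3's located numerals (`B13EntrywiseBlockNumerals.numerals_nodeA_of_dials`):
the decoration rate `ηΔ` (`hηΔ : 0 < ηΔ`, `hP2 : 2·cp.κ₁ ≤ ηΔ·M₁`), the junction loss `μΔ` (`hμΔ : 0 < μΔ`), ONE RATE BUDGET `hbudget : ηΔ + rf.εP + rf.kapP + 4μΔ ≤ ρΔ`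
(«the decoration rate, the far rate, the exchange rate and four junction losses fit under the fluctuation operator's decay rate») and ONE FLOOR
`hkbar : kbarFloor ν mF c₀ ρΔ ηΔ μΔ rC cp.κ₁ BΔ ≤ rf.KbarP` (the old `hKP` left side as a numeral); the far ∕ exchange rates `εΔ := ηΔ + rf.εP + 2μΔ`,
`κΔ := rf.kapP + 2μΔ` are chosen inside (`0 ≤ rf.εP`, `0 < rf.kapP` from `hrf`).  Every other binder VERBATIM module 67's, in its order; conclusion
`B13LeafOfRecord θ lamD.toC.toK.layer` BY NAME.  Count-neutral: hypotheses about the HIDDEN frame and the letters of the record's own object data; nothing of Bałaban's is asserted.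
[cite: Balaban1988RG2Cluster, Lemma 1 p.9, Lemma 2 p.11, Lemma 3 p.20, (1.11) p.5, (2.5)–(2.8) pp.12–14, (2.14)–(2.26) pp.15–17; Balaban1987RG1, (1.11)–(1.14) p.262;
Balaban1985BackgroundPropagators, Thm 3.10 (3.107)–(3.108) p.416; Balaban1984PropagatorsII, Lemma 2.1 (2.61) p.234] -/
theorem b13LeafOfRecord_decLayer_of_located_entrywise_numerals_rates
    (hN12 : 12 ≤ (θ.ℓ₆ + 1) * (lamD.toC.toK.layer.n + 1))
    -- (1) LEMMA 1: [I]'s block geometry of the (1.33) index families of the layer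
    (dist : TDom 4 ((θ.ℓ₆ + 1) * (lamD.toC.toK.layer.n + 1)) → TPt 4 ((θ.ℓ₆ + 1) * (lamD.toC.toK.layer.n + 1)) → (j : ℕ) →
      TPt 4 ((θ.ℓ₆ + 1) ^ (lamD.toC.toK.layer.k - j) * ((θ.ℓ₆ + 1) * (lamD.toC.toK.layer.n + 1))) → ℝ)
    {K K' : ℝ}
    (hS0Y : ∀ Y, ∀ a ∈ lamD.toC.toK.layer.S0 Y,
      (pbox (fun i => natLift a i - (5 : ℕ)) (fun i => natLift a i + 1 + (5 : ℕ))).image (proj ((θ.ℓ₆ + 1) * (lamD.toC.toK.layer.n + 1))) ⊆ Y.1)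
    (hFsub : ∀ Y a, lamD.toC.toK.layer.F Y a ⊆
      (pbox (fun i => natLift a i - (5 : ℕ)) (fun i => natLift a i + 1 + (5 : ℕ))).image (proj ((θ.ℓ₆ + 1) * (lamD.toC.toK.layer.n + 1))) \
        (pbox (fun i => natLift a i - (4 : ℕ)) (fun i => natLift a i + 1 + (4 : ℕ))).image (proj ((θ.ℓ₆ + 1) * (lamD.toC.toK.layer.n + 1))))
    (hSq : ∀ Y, ∀ a ∈ lamD.toC.toK.layer.S0 Y, ∀ j, lamD.toC.toK.layer.Sq Y a j ⊆
      (Finset.univ : Finset (TPt 4 ((θ.ℓ₆ + 1) ^ (lamD.toC.toK.layer.k - j) * ((θ.ℓ₆ + 1) * (lamD.toC.toK.layer.n + 1))))).filter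
        (fun q => tcoarse ((θ.ℓ₆ + 1) ^ (lamD.toC.toK.layer.k - j)) ((θ.ℓ₆ + 1) * (lamD.toC.toK.layer.n + 1)) q ∈
          (pbox (fun i => natLift a i - (2 : ℕ)) (fun i => natLift a i + 1 + (2 : ℕ))).image (proj ((θ.ℓ₆ + 1) * (lamD.toC.toK.layer.n + 1)))))
    (hScY : ∀ Y, lamD.toC.toK.layer.Sc Y ⊆ Y.1) (hdist0 : ∀ Y a j q, 0 ≤ lamD.toC.toK.layer.c.δ₀ * dist Y a j q)
    (hdist : ∀ Y a j (n : ℕ) q, q ∉ (pbox (fun i => (((θ.ℓ₆ + 1) ^ (lamD.toC.toK.layer.k - j) : ℕ) : ℤ) * natLift a i - (n + 1 : ℕ))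
      (fun i => (((θ.ℓ₆ + 1) ^ (lamD.toC.toK.layer.k - j) : ℕ) : ℤ) * natLift a i + 2 * (((θ.ℓ₆ + 1) ^ (lamD.toC.toK.layer.k - j) : ℕ) : ℤ) - 1 + (n + 1 : ℕ))).image
        (proj ((θ.ℓ₆ + 1) ^ (lamD.toC.toK.layer.k - j) * ((θ.ℓ₆ + 1) * (lamD.toC.toK.layer.n + 1)))) → lamD.toC.toK.layer.c.δ₀ * lamD.toC.toK.layer.c.M * ((n : ℝ) + 1) ≤ lamD.toC.toK.layer.c.δ₀ * dist Y a j q)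
    (hSX : ∀ Y a j q, lamD.toC.toK.layer.SX Y a j q ⊆ (tcubeSys 4 ((θ.ℓ₆ + 1) ^ (lamD.toC.toK.layer.k - j) * ((θ.ℓ₆ + 1) * (lamD.toC.toK.layer.n + 1)))).above q)
    (hSX' : ∀ Y a j q, lamD.toC.toK.layer.SX' Y a j q ⊆ (tcubeSys 4 ((θ.ℓ₆ + 1) ^ (lamD.toC.toK.layer.k - j) * ((θ.ℓ₆ + 1) * (lamD.toC.toK.layer.n + 1)))).above q)
    (hX0 : ∀ Y, ∀ a ∈ lamD.toC.toK.layer.Sc Y, ∀ j ∈ Finset.range (lamD.toC.toK.layer.k + 1), ∀ q ∈ lamD.toC.toK.layer.Sq' Y a j, ∀ x ∈ lamD.toC.toK.layer.SX' Y a j q,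
      x.1.image (tcoarse ((θ.ℓ₆ + 1) ^ (lamD.toC.toK.layer.k - j)) ((θ.ℓ₆ + 1) * (lamD.toC.toK.layer.n + 1))) ⊆ Y.1)
    -- (1) LEMMA 1: per-term analyticity on (1.34)
    (hAnT : ∀ Y, ∀ a ∈ lamD.toC.toK.layer.S0 Y, ∀ X ∈ (lamD.toC.toK.layer.F Y a).powerset, ∀ j ∈ Finset.range (lamD.toC.toK.layer.k + 1), ∀ q ∈ lamD.toC.toK.layer.Sq Y a j,
      ∀ x ∈ lamD.toC.toK.layer.SX Y a j q, AnalyticOnNhd ℂ (lamD.toC.toK.layer.T Y a X j q x) (lamD.toC.toK.layer.sp1 Y))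
    (hAnT' : ∀ Y, ∀ a ∈ lamD.toC.toK.layer.Sc Y, ∀ j ∈ Finset.range (lamD.toC.toK.layer.k + 1), ∀ q ∈ lamD.toC.toK.layer.Sq' Y a j, ∀ x ∈ lamD.toC.toK.layer.SX' Y a j q,
      AnalyticOnNhd ℂ (lamD.toC.toK.layer.T' Y a j q x) (lamD.toC.toK.layer.sp1 Y))
    -- (1) LEMMA 1: thresholds and restrictions on the residual constants
    (hK : 0 ≤ K) (hK' : 0 ≤ K') (hκ : 0 ≤ lamD.toC.toK.layer.c.κ) (hδ1 : lamD.toC.toK.layer.c.δ < 1)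
    (hδκ : 1 ≤ lamD.toC.toK.layer.c.δ * lamD.toC.toK.layer.c.κ) (hκ126 : kappa₀ 64 8 ≤ lamD.toC.toK.layer.c.κ)
    (hκ126' : kappa₀ 64 8 ≤ lamD.toC.toK.layer.c.δ * lamD.toC.toK.layer.c.κ) (hκ₁ : 1 + 2 * Real.log (8 * 12 ^ 3) ≤ lamD.toC.toK.layer.c.κ₁)
    (hκ₁' : 2 + 16 * Real.log 128 ≤ lamD.toC.toK.layer.c.κ₁) (hδ₀M : 10 * Real.exp (-1) ≤ lamD.toC.toK.layer.c.δ₀ * lamD.toC.toK.layer.c.M)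
    (hδ₀M5 : 2 * Real.log 5 ≤ lamD.toC.toK.layer.c.δ₀ * lamD.toC.toK.layer.c.M)
    (hR8 : (1 - lamD.toC.toK.layer.c.δ) * lamD.toC.toK.layer.c.κ ≤ (1 / 4) * (lamD.toC.toK.layer.c.κ₁ - 1))
    (hR9 : (1 - 2 * lamD.toC.toK.layer.c.δ) * lamD.toC.toK.layer.c.κ ≤ (1 / 16) * lamD.toC.toK.layer.c.κ₁)
    -- (1) LEMMA 1: per-term (1.24), (1.30) by reference to [I] (3.54), (3.17), [15] Prop. 4, [13] (3.108); the constants with headroom (1 − θ₁)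
    (h124 : ∀ Y φ, φ ∈ lamD.toC.toK.layer.sp1 Y → ∀ a ∈ lamD.toC.toK.layer.S0 Y, ∀ X ∈ (lamD.toC.toK.layer.F Y a).powerset, ∀ j ∈ Finset.range (lamD.toC.toK.layer.k + 1), ∀ q ∈ lamD.toC.toK.layer.Sq Y a j,
      ∀ x ∈ lamD.toC.toK.layer.SX Y a j q,
        ‖lamD.toC.toK.layer.T Y a X j q x φ‖ ≤ K * (((θ.ℓ₆ + 1 : ℕ) : ℝ) ^ j * (((θ.ℓ₆ + 1 : ℕ) : ℝ) ^ lamD.toC.toK.layer.k)⁻¹) ^ 5 *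
          Real.exp (-(lamD.toC.toK.layer.c.κ₁ - 1) *
            (((Y.1 \ (pbox (fun i => natLift a i - (5 : ℕ)) (fun i => natLift a i + 1 + (5 : ℕ))).image
              (proj ((θ.ℓ₆ + 1) * (lamD.toC.toK.layer.n + 1)))).card : ℝ) + X.card)) *
          Real.exp (-(lamD.toC.toK.layer.c.κ * torusTreeLen x.1)))
    (h130 : ∀ Y φ, φ ∈ lamD.toC.toK.layer.sp1 Y → ∀ a ∈ lamD.toC.toK.layer.Sc Y, ∀ j ∈ Finset.range (lamD.toC.toK.layer.k + 1), ∀ q ∈ lamD.toC.toK.layer.Sq' Y a j,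
      ∀ x ∈ lamD.toC.toK.layer.SX' Y a j q,
        ‖lamD.toC.toK.layer.T' Y a j q x φ‖ ≤ K' * Real.exp (-(1 / 2) * (lamD.toC.toK.layer.c.δ₀ * lamD.toC.toK.layer.c.M) * (((θ.ℓ₆ + 1 : ℕ) : ℝ) ^ j * (((θ.ℓ₆ + 1 : ℕ) : ℝ) ^ lamD.toC.toK.layer.k)⁻¹)⁻¹
            - (1 / 2) * lamD.toC.toK.layer.c.δ₀ * dist Y a j q) *
          Real.exp (-(lamD.toC.toK.layer.c.κ₁ - 1) * ((Y.1 \ x.1.image (tcoarse ((θ.ℓ₆ + 1) ^ (lamD.toC.toK.layer.k - j)) ((θ.ℓ₆ + 1) * (lamD.toC.toK.layer.n + 1)))).card : ℝ)) *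
          Real.exp (-(lamD.toC.toK.layer.c.κ * torusTreeLen x.1)))
    {θ₁ : ℝ} (hθ₁0 : 0 ≤ θ₁) (hθ₁1 : θ₁ < 1)
    (hC : K * K₀ 64 8 * (2 * (6 * ((θ.ℓ₆ + 1 : ℕ) : ℝ)) ^ 4) * Real.exp 1 * Real.exp ((1 / 8) * lamD.toC.toK.layer.c.κ₁ * (12 ^ 4 - 1)) +
        2 * (64 * K') * K₀ 64 8 * 1344 ≤
      (1 - θ₁) * (lamD.toC.toK.layer.c.E₀ * lamD.toC.toK.layer.c.ε₁ * lamD.toC.toK.layer.c.C₁ * lamD.toC.toK.layer.c.M ^ lamD.toC.toK.layer.c.q * Real.exp (lamD.toC.toK.layer.c.C₂ * lamD.toC.toK.layer.c.κ₁)))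
    -- (2) LEMMA 2 (pp. 10–11): the curvature terms; the located per-term data of `B13Lemma2Torus.lemma2Printed_twoTorus'` for the layer's plaquette data
    (hGlAn : ∀ Y, AnalyticOnNhd ℂ (lamD.toC.toK.layer.Gl Y) (lamD.toC.toK.layer.sp1 Y))
    (hGl : ∀ Y φ, φ ∈ lamD.toC.toK.layer.sp1 Y → ‖lamD.toC.toK.layer.Gl Y φ‖ ≤ θ₁ * (lamD.toC.toK.layer.c.E₀ * lamD.toC.toK.layer.c.ε₁ * lamD.toC.toK.layer.c.C₁ * lamD.toC.toK.layer.c.M ^ lamD.toC.toK.layer.c.q * Real.exp (lamD.toC.toK.layer.c.C₂ * lamD.toC.toK.layer.c.κ₁)) *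
      Real.exp (-((1 - 2 * lamD.toC.toK.layer.c.δ) * lamD.toC.toK.layer.c.κ * (tsys 4 ((θ.ℓ₆ + 1) * (lamD.toC.toK.layer.n + 1))).dj Y)))
    (he : ∀ Y b, ‖lamD.toC.toK.layer.e Y b‖ ≤ 1) (hg : lamD.toC.toK.layer.g ≠ 0) {R K₂ : ℝ} {m₂ : ℕ} (hK₂ : 0 ≤ K₂) (hR : 0 < R)
    (hε3 : 3 * lamD.toC.toK.layer.c.ε₁ ≤ R)
    (hW : ∀ Y, ∀ i ∈ lamD.toC.toK.layer.s Y, ∀ φ ∈ lamD.toC.toK.layer.sp1 Y, AnalyticOnNhd ℂ (lamD.toC.toK.layer.Wf Y i φ) (ball 0 R))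
    (hKW : ∀ Y, ∀ i ∈ lamD.toC.toK.layer.s Y, ∀ φ ∈ lamD.toC.toK.layer.sp1 Y, ∀ z ∈ ball (0 : lamD.toC.toK.layer.E) R,
      ‖lamD.toC.toK.layer.Wf Y i φ z‖ ≤ K₂ * Real.exp (-(lamD.toC.toK.layer.c.κ₁ - 1) * ((Y.1.card : ℝ) - 1)) * ‖z‖ ^ 3)
    (hcard : ∀ Y, (lamD.toC.toK.layer.s Y).card ≤ m₂ * Y.1.card)
    (hsp : ∀ Y φ, φ ∈ lamD.toC.toK.layer.sp1 Y → ‖lamD.toC.toK.layer.g‖ * ‖lamD.toC.toK.layer.rd Y φ‖ < lamD.toC.toK.layer.c.ε₁)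
    (hfloor : 27 * m₂ * K₂ * Real.exp (lamD.toC.toK.layer.c.κ₁ - 1) ≤ lamD.toC.toK.layer.c.C₃ * lamD.toC.toK.layer.c.M ^ 4 * Real.exp (lamD.toC.toK.layer.c.C₂ * lamD.toC.toK.layer.c.κ₁))
    (hAnP : ∀ Y, ∀ i ∈ lamD.toC.toK.layer.s Y, AnalyticOnNhd ℂ (fun φ => scaled lamD.toC.toK.layer.g (lamD.toC.toK.layer.Wf Y i φ) (lamD.toC.toK.layer.rd Y φ)) (lamD.toC.toK.layer.sp1 Y))
    (hG : ∀ Y, lamD.toC.toK.layer.GaugeInv (lamD.toC.toK.layer.V Y) ∧ lamD.toC.toK.layer.GaugeInv ((WtOfRecord θ lamD.toC.toK.layer).toStepData.quadForm Y) ∧ lamD.toC.toK.layer.GaugeInv (lamD.toC.toK.layer.Vpp Y))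
    -- (3) LEMMA 3 (pp. 14–20): the signs of (2.18)–(2.20), R12, |τ(Y)| ≥ 2, and the numerics bundle at ℓ = ½L
    (hL8 : 8 ≤ θ.ℓ₆ + 1) {a a₂ a₂' a₅ Aabs : ℝ}
    (hN : Lemma3Numerics (c13OfRecord θ lamD.toC.toK.layer) (lamD.toC.toK.layer.m₃ + 1) (((θ.ℓ₆ + 1 : ℕ) : ℝ) / 2) a a₂ a₂' a₅ Aabs)
    (h12 : R12 (c13OfRecord θ lamD.toC.toK.layer)) (hE : 0 < lamD.toC.toK.layer.c.E₀) (hε : 0 < lamD.toC.toK.layer.c.ε₁)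
    (hC₁ : 0 < lamD.toC.toK.layer.c.C₁) (hα : 0 < lamD.toC.toK.layer.c.α₄) (hM : 1 ≤ lamD.toC.toK.layer.c.M)
    (hτ2 : lamD.toC.toK.layer.c.E₀ * lamD.toC.toK.layer.c.ε₁ * lamD.toC.toK.layer.c.C₁ * lamD.toC.toK.layer.c.α₄⁻¹ * lamD.toC.toK.layer.c.M ^ lamD.toC.toK.layer.c.q * Real.exp (lamD.toC.toK.layer.c.C₂ * lamD.toC.toK.layer.c.κ₁) ≤ 1 / 2)
    -- (3) the Cauchy radius and the parameter domains (p. 15)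
    -- the bigger σ-polydisc (a second constants record `cp` lending its `κ₁`; NODE A's kernels are tagged at `cp`) and a
    -- Cauchy radius `r ≤ 1`; the τ-regions are the open discs of radii `2|τ(Y)|` (chosen inside)
    (cp : B13.Consts) (hκp : lamD.toC.toK.layer.c.κ₁ < cp.κ₁) (hr : 0 < lamD.toC.toK.r) (hr1 : lamD.toC.toK.r ≤ 1)
    -- (3) THE DICTIONARY IS def-B13's KERNEL TOWER (`lamD.toC.toK.𝒦 ∕ uOf ∕ r ∕ lZ ∕ lD ∕ Gam ∕ chiY₀ ∕ chicP ∕ Pl ∕ rP ∕ Vr ∕ emb`, `Dfam := 𝐃`; `Γ(σ) = G(σ)·` is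
    --     `ResidB13K.Gam_eq`): only the configuration size `α` and the `|P|` row-bond count stay located
    {α : ℝ} (hαnn : 0 ≤ α)
    (huα : ∀ Z, ∀ t ∈ terms (θ.ℓ₆ + 1) (lamD.toC.toK.layer.m₃ + 1) Z, ∀ φ ∈ lamD.toC.toK.layer.sp2 Z, ‖lamD.toC.toK.uOf Z t φ‖ ≤ α)
    (hPcard : ∀ Z, ∀ t ∈ terms (θ.ℓ₆ + 1) (lamD.toC.toK.layer.m₃ + 1) Z, (lamD.toC.toK.Pl Z t).card = t.2.card)
    -- (3) the record's objects behind the terms: bonds, cubes, the real field inside the configurations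
    (ιb : (Z : TDom 4 (lamD.toC.toK.layer.n + 1)) → (t : Finset (TDom 4 ((θ.ℓ₆ + 1) * (lamD.toC.toK.layer.n + 1))) × Finset (TBond 4 (lamD.toC.toK.layer.m₃ + 1) ((θ.ℓ₆ + 1) * (lamD.toC.toK.layer.n + 1)))) → (lamD.toC.toK.𝒦 Z t).Λ → lamD.toC.toK.layer.Bond)
    (hι : ∀ Z t, Function.Injective (ιb Z t)) (cube : lamD.toC.toK.layer.Bond → TPt 4 ((θ.ℓ₆ + 1) * (lamD.toC.toK.layer.n + 1)))
    (hQsupp : ∀ (Y : TDom 4 ((θ.ℓ₆ + 1) * (lamD.toC.toK.layer.n + 1))) φ b b', lamD.toC.toK.layer.Q Y φ b b' ≠ 0 → cube b ∈ Y.1 ∧ cube b' ∈ Y.1) {m' : ℕ}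
    (hfibc : ∀ Z t (x : TPt 4 ((θ.ℓ₆ + 1) * (lamD.toC.toK.layer.n + 1))), (Finset.univ.filter fun j => cube (ιb Z t j) = x).card ≤ m')
    (hBv : ∀ Z t φ B b, lamD.toC.toK.layer.Bv (lamD.toC.toK.emb Z t φ B) (ιb Z t b) = (B b : ℂ))
    (hBv0 : ∀ Z t φ B b', b' ∉ Set.range (ιb Z t) → lamD.toC.toK.layer.Bv (lamD.toC.toK.emb Z t φ B) b' = 0)
    (hχsupp : ∀ Z, ∀ t ∈ terms (θ.ℓ₆ + 1) (lamD.toC.toK.layer.m₃ + 1) Z, ∀ φ ∈ lamD.toC.toK.layer.sp2 Z, ∀ B, lamD.toC.toK.chiY₀ Z t B ≠ 0 → ∀ Y ∈ t.1,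
      lamD.toC.toK.emb Z t φ B ∈ lamD.toC.toK.layer.sp1 Y)
    -- (3) measurability of the layer's potentials and small-field region in the bond variables (`χ_{k,Y₀}` of record IS measurable, §0)
    (hVm : ∀ Z t φ Y, Measurable (lamD.toC.toK.Vr Z t φ Y))
    (hsmallm : ∀ Z t φ, MeasurableSet {B : (lamD.toC.toK.𝒦 Z t).Λ → ℝ | ∀ Y ∈ t.1, lamD.toC.toK.emb Z t φ B ∈ lamD.toC.toK.layer.sp1 Y}) {γ₂ : ℝ}
    (hγ₂ : 0 ≤ γ₂)
    -- (3) uniform fibre bounds of the bond locations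
    {m : ℕ} (hfibN : ∀ Z t (x : UT lamD.toC.toK.Nf), (Finset.univ.filter fun j => (lamD.toC.toK.𝒦 Z t).locN j = x).card ≤ m)
    -- (3) THE REFERENCE RUNG ON THE TERMS OF THE STEP OF RECORD (the displayed hypothesis, n10-b's reference currency):
    --     ONE admissible reference package `rf`, an accretivity radius `0 < R₁ < R`, print's two perturbative sources (p. 15:
    --     «O(1)e^{−⅓δ₀M} + O(α₀ + α₁)» against the reference positivity) as FOUR DIVISION-FREE THRESHOLDS, positive input
    --     rates and `η ≤ etaMax` of the W-walks package `rf.toWalkPackage R₁` (standard rate book: `κ_C = κ_C⋆`, `ρ′ = μ∕4`),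
    --     `TermWalksRef` for the kernels of every term, round letters, and PRINT's TWO EXCHANGE THRESHOLDS for a `θ₀ > 0`
    (rf : RefPackage) (hrf : rf.Admissible) {R₁ : ℝ} (hR₁ : 0 < R₁) (hR₁R : R₁ < rf.R)
    (hPσ : 8 * rf.KbarP * rf.cV₀ * Real.exp (-(rf.εP * rf.Rσ)) ≤ rf.m₀) (hP₁ : 8 * rf.KbarP * rf.cV₀ * R₁ ≤ rf.m₀ * rf.R)
    (hAσ : 8 * rf.KbarA * rf.cV * Real.exp (-(rf.εA * rf.Rσ)) ≤ rf.mA₀) (hA₁ : 8 * rf.KbarA * rf.cV * R₁ ≤ rf.mA₀ * rf.R)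
    (hp : (rf.toWalkPackage R₁).PositiveRates) (hη : rf.η ≤ (rf.toWalkPackage R₁).etaMax) (hαR : α < R₁)
    -- (3) NODE A's KERNEL DATA READ OFF ONE OPERATOR PER TERM — print's `C*Δ_k(σ(Z),𝐔,𝐉)C` after the conditioning (2.5)–(2.6): block
    --     reading; ONE expansion at `rf`'s full-precision letters whose terms are `s`-MONOMIALS times σ-free operators ([II] p. 3) and
    --     carry a WALK REVERSAL ([13] (3.107)); ONE positivity; geometry; dominations in `rf`
    (hKX : ∀ Z, ∀ t ∈ terms (θ.ℓ₆ + 1) (lamD.toC.toK.layer.m₃ + 1) Z, (lamD.toC.toK.𝒦 Z t).X.Nonempty)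
    -- (3″) NODE A's OBJECT DATA AS ENTRYWISE LETTERS (census v5 class A2′ in its ENTRYWISE form ∧ A2″ as ONE geometric letter ∧ A2‴; replaces
    --      module 21's `hKexp`; ym-nodeO-ideate P2 g30's reduction, tree module `B13EntrywiseWalks`): per term, the fine-bond index `lamD.P Z t` located by
    --      `locF`; TWO ENTRYWISE LETTERS of the σ-free fluctuation operator `lamD.Δ₀ Z t` on the complex `rf.R`-ball — (3.108)-type decay
    --      `‖Δ₀(u)_{ij}‖ ≤ B·e^{−ρ·d₁(i,j)}` and entrywise holomorphy (`RawEntryLetters`) —, a fibre bound; the cube decoration `J` on PAIRS of fine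
    --      bonds with the GEODESIC letter (`|J(i,j)| ≤ c₀ + d₁(i,j)∕M₁`, a decorated pair joined by a `d₁`-geodesic through `(lamD.toC.toK.𝒦 Z t).X`); the (1.11)
    --      numerics `0 < η ≤ ε < ρ`, `2κ₁ ≤ ηM₁`; the REAL constant local averaging operator `lamD.Cm Z t` of (2.5) (`|C| ≤ 1`, range `rC`); a junction
    --      rate `μΔ`; the letter match with `rf`; and `lamD.toC.KK Z t` IS `Cᵀ·sDecorate(J′, ½raw ⊕ ½rawᵀ)·C` (`hKK`)
    {ρΔ BΔ ηΔ μΔ M₁ rC : ℝ} {mF c₀ : ℕ}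
    (hEL : ∀ Z, ∀ t ∈ terms (θ.ℓ₆ + 1) (lamD.toC.toK.layer.m₃ + 1) Z, RawEntryLetters (lamD.Δ₀ Z t) (lamD.locF Z t) rf.R ρΔ BΔ)
    (hfibF : ∀ Z t (y : UT lamD.toC.toK.Nf), (Finset.univ.filter fun k => lamD.locF Z t k = y).card ≤ mF)
    (hGJ : ∀ Z, ∀ t ∈ terms (θ.ℓ₆ + 1) (lamD.toC.toK.layer.m₃ + 1) Z, GeodesicDecoration (lamD.J Z t) (lamD.locF Z t) (lamD.toC.toK.𝒦 Z t).X c₀ M₁)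
    (hηΔ : 0 < ηΔ) (hP2 : 2 * cp.κ₁ ≤ ηΔ * M₁) (hCle : ∀ Z t k i, |lamD.Cm Z t k i| ≤ 1)
    (hCsupp : ∀ Z t k i, lamD.Cm Z t k i ≠ 0 → tdist1 lamD.toC.toK.Nf (lamD.locF Z t k) ((lamD.toC.toK.𝒦 Z t).locN i) ≤ rC) (hμΔ : 0 < μΔ)
    -- (3″) THE (1.11) NUMERICS + JUNCTION-RATE CHAIN AS n10-w3's LOCATED NUMERALS (`B13EntrywiseBlockNumerals`, dial form):
    --      ONE rate budget and ONE floor replace `εΔ κΔ hηε hρε hμε hμκ hκεΔ hεP hkapP hKP`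
    (hbudget : ηΔ + rf.εP + rf.kapP + 4 * μΔ ≤ ρΔ)
    (hkbar : kbarFloor lamD.toC.toK.ν mF c₀ ρΔ ηΔ μΔ rC cp.κ₁ BΔ ≤ rf.KbarP)
    (hKacc : ∀ Z, ∀ t ∈ terms (θ.ℓ₆ + 1) (lamD.toC.toK.layer.m₃ + 1) Z, ∀ v : (lamD.toC.toK.𝒦 Z t).Λ ⊕ (lamD.toC.toK.𝒦 Z t).C₀ → ℂ,
      rf.m₀ * ∑ i, ‖v i‖ ^ 2 ≤ (∑ i, star (v i) * (lamD.toC.KK Z t 0 0 *ᵥ v) i).re)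
    (hKfar : ∀ Z, ∀ t ∈ terms (θ.ℓ₆ + 1) (lamD.toC.toK.layer.m₃ + 1) Z, ∀ k, ∀ z ∈ (lamD.toC.toK.𝒦 Z t).X, rf.Rσ ≤ tdist1 lamD.toC.toK.Nf ((lamD.toC.toK.𝒦 Z t).locN k) z)
    (hKmult : ∀ Z, ∀ t ∈ terms (θ.ℓ₆ + 1) (lamD.toC.toK.layer.m₃ + 1) Z, ∀ x : UT lamD.toC.toK.Nf,
      (Finset.univ.filter fun k => (lamD.toC.toK.𝒦 Z t).locN k = x).card ≤ rf.nB)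
    (hKdim : lamD.toC.toK.ν ≤ rf.dm) (hεL : rf.εL ≤ rf.εP) (hκL : rf.kapL ≤ rf.kapP) (hKL : rf.KbarP ≤ rf.KbarL) (hεA : rf.εA ≤ rf.εP)
    (hκA : rf.kapA ≤ rf.kapP) (hKA : rf.KbarP ≤ rf.KbarA) (hmA : rf.mA₀ ≤ rf.m₀) {θ₀ : ℝ} (hθ₀ : 0 < θ₀)
    (hαsmall : α ≤ θ₀ * R₁ / (4 * (rf.toWalkPackage R₁).Kbar + 4))
    (hRσlarge : Real.log ((4 * (rf.toWalkPackage R₁).Kbar + 4) / θ₀)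
      / ((rf.toWalkPackage R₁).mu / 4 - (rf.toWalkPackage R₁).kapCStar) ≤ rf.Rσ)
    -- (3) THE (2.24)–(2.25) SMALLNESS AS n10-w1's THREE LOCATED NUMERALS (`B13Bound226Numerals`: canonical rate chain `j·κ_C⋆∕5`,
    --     `ϑ := theta`, `K_G := K̄`, `K_Cs := 8∕m_{A,0}`, `c_E := 2∕m_{A,0}`): `θ₀ ≤ θ₀max`, `γ₂ ≤ γ₂max`, `M⁴min ≤ M⁴`
    (hθle : θ₀ ≤ theta0Max m lamD.toC.toK.ν (rf.toWalkPackage R₁).kapCStar (rf.toWalkPackage R₁).Kbar (8 / rf.mA₀) (2 / rf.mA₀) (rf.toWalkPackage R₁).BΓ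
      rf.cV (B6.c0 1 rf.η) rf.mA₀)
    (hγle : γ₂ ≤ gamma2Max m lamD.toC.toK.ν (2 / rf.mA₀) (rf.toWalkPackage R₁).BΓ rf.cV (B6.c0 1 rf.η) rf.mA₀)
    (hM4 : m4Min m lamD.toC.toK.ν m' (2 / rf.mA₀) (rf.toWalkPackage R₁).BΓ rf.cV (B6.c0 1 rf.η) rf.mA₀ lamD.toC.toK.layer.c.α₄ lamD.toC.toK.layer.c.κ₁ ≤ lamD.toC.toK.layer.c.M ^ 4)
    -- (3) constant matching, p. 17: `a ≤ γ₂ r_P²` and the volume factor with `w = 2·K₀(64,8)·α₄·#(⋃𝐃)`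
    (hPa : a ≤ γ₂ * lamD.toC.toK.rP ^ 2)
    -- (3) the volume factor in θ-FREE COUNT FORM (`B13Bound226Numerals.vol_of_counts`): `2|Λ| + ½|Λ ⊕ C₀| + 2K₀(64,8)α₄·#⋃𝐃 ≤ a₅|Z|`
    (hcount : ∀ Z, ∀ t ∈ terms (θ.ℓ₆ + 1) (lamD.toC.toK.layer.m₃ + 1) Z,
      2 * (Fintype.card (lamD.toC.toK.𝒦 Z t).Λ : ℝ) + (Fintype.card ((lamD.toC.toK.𝒦 Z t).Λ ⊕ (lamD.toC.toK.𝒦 Z t).C₀) : ℝ) / 2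
        + 2 * (K₀ 64 8 * lamD.toC.toK.layer.c.α₄ * ((((t.1).image Subtype.val).biUnion id).card : ℝ)) ≤ a₅ * ((Z.1).card : ℝ)) :
    B13LeafOfRecord θ lamD.toC.toK.layer := by
  obtain ⟨εΔ, κΔ, -, hηε, hρε, -, -, hμε, hμκ, hκεΔ, hεP, hkapP, hKP⟩ :=
    numerals_nodeA_of_dials (ν := lamD.toC.toK.ν) (mF := mF) (c₀ := c₀) (rC := rC) (BΔ := BΔ)
      hηΔ hP2 hμΔ hrf.hεP hrf.hkapP.le hbudget hkbar
  exact b13LeafOfRecord_decLayer_of_located_entrywise_numerals θ lamD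
    hN12 dist hS0Y hFsub hSq hScY hdist0 hdist hSX hSX' hX0 hAnT hAnT' hK hK' hκ hδ1 hδκ hκ126 hκ126' hκ₁ hκ₁' hδ₀M hδ₀M5 hR8 hR9 h124 h130 hθ₁0 hθ₁1
    hC hGlAn hGl he hg hK₂ hR hε3 hW hKW hcard hsp hfloor hAnP hG hL8 hN h12 hE hε hC₁ hα hM hτ2 cp hκp hr hr1 hαnn huα hPcard ιb hι cube hQsupp
    hfibc hBv hBv0 hχsupp hVm hsmallm hγ₂ hfibN rf hrf hR₁ hR₁R hPσ hP₁ hAσ hA₁ hp hη hαR hKX hEL hfibF hGJ hηΔ hηε hρε hP2 hCle hCsupp hμΔ hμε hμκ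
    hκεΔ hεP hkapP hKP hKacc hKfar hKmult hKdim hεL hκL hKL hεA hκA hKA hmA hθ₀ hαsmall hRσlarge hθle hγle hM4 hPa hcount

end DecLayer

end Summit.QuantumFields.YangMills.BalabanUVNodes.N10B13KernelTowerWalksEntrywiseNumeralsDecoratedRates

end
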